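import Summits.FinalStateConjecture.FinalStateConjecture.Theorems.BulkKerrCapture.Negative.SpinGapAndMass
import Literature.Geometry.Lorentzian.LeviCivitaProofs
import Literature.Geometry.Lorentzian.KerrDataSchwarzschildConstraints

/-!
# `BulkKerrCapture` (stmt-FinalStateConjecture-10696, route PhaseMixingCapture) — negative-side
# lemmas V: the crux's prediction at the Schwarzschild centre, free of named-fact hypotheses

Refuter seat `refuter-cdisprove-stmt-FinalStateConjecture-10696-g2-0` (standing disprover, cycle 2),
2026-08-16; workfile `Cruxes/BulkKerrCapture/Disproof.lean`. Nothing here closes the item.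

Cycle 1's centre-of-ball lemma `captureAt_atKerrData` / `bulkKerrCapture_atKerrData` took the
Levi-Civita fact and the constraint fact of the Kerr data as hypotheses. For the Schwarzschild
members `a = 0` both are now THEOREMS of the tree (`PseudoRiemannianMetric.hasLeviCivita`,
`Kerr.data_isVacuumConstraintSolution_zero`), so the crux yields, with NO named-fact hypothesis
left (only its own instance binders), the concrete falsifiable prediction

* `bulkKerrCapture_atSchwarzschildData`: for every `M > 0` there is `k` such that EVERY maximal
  vacuum Cauchy development of the Schwarzschild Kerr–Schild slice data `Kerr.data M 0 M` on
  `{t* = 0, r > M}` has far-complete `𝓘⁺` (sojourn form from `{‖y‖ ≥ afRadius 0 M + 1}`) and a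
  region converging in `Cᵏ` to `g_{M,0}` in the Kerr–Schild pullback gauge;

and the same at every sub-extremal spin granted only the constraint fact at that spin
(`bulkKerrCapture_atKerrData'`). On paper both hold (outgoing rays complete; ingoing far rays die
on the outgoing null cone of the inner edge `r = M` — resp. at `r = 0` — only after sojourn
`≳ (R + R₀)/2 − r₊ → ∞`; the late chart is the inclusion precomposed with a `t*`-squeeze), so this
is a sanity obligation for the prover, not a kill — but it is the cheapest place where a future
in-tree construction of the Schwarzschild MGHD would test the crux.

References: Choquet-Bruhat 2009, Ch. VI, Thm. 3.3 (constraints of induced data); O'Neill 1983,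
Ch. 3, Thm. 3.11 (Levi-Civita); Dafermos–Holzegel–Rodnianski–Taylor arXiv:2104.08222, §1
(Schwarzschild as the `a = 0` member of the Kerr family to which perturbations converge).
-/

-- the problem namespace `FinalStateConjecture.FinalStateConjecture` (single-conjunct summit) trips dupNamespace
set_option linter.dupNamespace false

noncomputable section

open Set
open scoped Manifold ENNReal ContDiff

namespace Summit.FinalStateConjecture.FinalStateConjecture.Theorems.BulkKerrCapture.Negative

open Literature.Geometry.Lorentzian
open Summit.FinalStateConjecture.FinalStateConjecture.Theses.PhaseMixingCapture (BulkKerrCapture)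

/-- **Centre of the ball, Levi-Civita hypothesis discharged.** `CaptureAt … ε C a` with `ε > 0`
and the constraint fact of the centre datum force every MGHD of `Kerr.data M a M` to be
far-complete and to converge in `Cᵏ` to `g_{M,a}` itself (the modulus pins `(M', a') = (M, a)`).
[folklore] -/
theorem captureAt_atKerrData' [Kerr.Facts] [Kerr.SliceFacts] {s : ℕ} {δ : ℝ} {k : ℕ} {M : ℝ}
    {hM : 0 ≤ M} {ε C a : ℝ} (hε : 0 < ε) (h : CaptureAt s δ k M hM ε C a)
    (hvac : Kerr.data_isVacuumConstraintSolution M a M)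
    (𝒟 : VacuumCauchyDevelopment (Kerr.data M a M hM)) (hmax : 𝒟.IsMaximal) :
    𝒟.HasCompleteFutureNullInfinityFar ∧
      ∃ 𝒟oc : Set 𝒟.carrier, 𝒟.toSpacetime.ConvergesToKerr 𝒟oc M a k := by
  haveI := (Kerr.data M a M hM).metric.hasLeviCivita
  have h0 : InitialDataSet.dataWeightedSobolevEDist s δ (Kerr.data M a M hM)
      (Kerr.data M a M hM) < ENNReal.ofReal ε := by
    rw [InitialDataSet.dataWeightedSobolevEDist_self]
    exact ENNReal.ofReal_pos.2 hε
  obtain ⟨M', a', 𝒟oc, -, hnull, hconv, hpar⟩ := h _ (hvac hM) h0 𝒟 hmax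
  rw [InitialDataSet.dataWeightedSobolevEDist_self, ENNReal.toReal_zero, Real.sqrt_zero,
    mul_zero] at hpar
  have h1 : |M' - M| ≤ 0 := by linarith [abs_nonneg (a' - a)]
  have h2 : |a' - a| ≤ 0 := by linarith [abs_nonneg (M' - M)]
  have hM' : M' = M := by linarith [abs_le.1 h1]
  have ha' : a' = a := by linarith [abs_le.1 h2]
  subst hM' ha'
  exact ⟨hnull, 𝒟oc, hconv⟩

/-- **The crux at a sub-extremal centre, modulo the constraint fact at that spin only.**
[folklore] -/
theorem bulkKerrCapture_atKerrData' (h : BulkKerrCapture) [Kerr.Facts] [Kerr.SliceFacts]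
    {M a : ℝ} (hM : 0 < M) (ha : Kerr.IsSubextremal M a)
    (hvac : Kerr.data_isVacuumConstraintSolution M a M) :
    ∃ k : ℕ, ∀ 𝒟 : VacuumCauchyDevelopment (Kerr.data M a M hM.le), 𝒟.IsMaximal →
      𝒟.HasCompleteFutureNullInfinityFar ∧
        ∃ 𝒟oc : Set 𝒟.carrier, 𝒟.toSpacetime.ConvergesToKerr 𝒟oc M a k := by
  rw [bulkKerrCapture_iff] at h
  have ha₁ : |a| / M < 1 := by
    rw [div_lt_one hM]
    exact ha
  obtain ⟨s, δ, k, hk⟩ := h (|a| / M) ha₁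
  obtain ⟨ε, hε, C, hC⟩ := hk M hM
  have hspin : |a| ≤ |a| / M * M := by rw [div_mul_cancel₀ _ hM.ne']
  exact ⟨k, fun 𝒟 hmax ↦ captureAt_atKerrData' hε (hC a hspin) hvac 𝒟 hmax⟩

/-- **The crux's prediction at the Schwarzschild centre — no named-fact hypothesis left.** If
`BulkKerrCapture` holds then for every `M > 0` some `k` works for EVERY maximal vacuum Cauchy
development of the Schwarzschild Kerr–Schild slice data `Kerr.data M 0 M`: far-complete `𝓘⁺` and
`Cᵏ`-convergence to `g_{M,0}`. (The `a = 0` constraints are the tree theorem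
`Kerr.data_isVacuumConstraintSolution_zero`.) [folklore] -/
theorem bulkKerrCapture_atSchwarzschildData (h : BulkKerrCapture) [Kerr.Facts] [Kerr.SliceFacts]
    {M : ℝ} (hM : 0 < M) :
    ∃ k : ℕ, ∀ 𝒟 : VacuumCauchyDevelopment (Kerr.data M 0 M hM.le), 𝒟.IsMaximal →
      𝒟.HasCompleteFutureNullInfinityFar ∧
        ∃ 𝒟oc : Set 𝒟.carrier, 𝒟.toSpacetime.ConvergesToKerr 𝒟oc M 0 k :=
  bulkKerrCapture_atKerrData' h hM (by unfold Kerr.IsSubextremal; simpa using hM)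
    (Kerr.data_isVacuumConstraintSolution_zero M M)

/-- Contrapositive, the shape of the only remaining kill on this side: ONE maximal vacuum Cauchy
development of ONE Schwarzschild slice datum `Kerr.data M 0 M` that is not far-complete, or admits
no `Cᵏ`-converging late Kerr–Schild chart for any `k`, refutes the crux outright (given the two
instance facts). [folklore] -/
theorem not_bulkKerrCapture_of_schwarzschild_mghd [Kerr.Facts] [Kerr.SliceFacts] {M : ℝ}
    (hM : 0 < M) (𝒟 : VacuumCauchyDevelopment (Kerr.data M 0 M hM.le)) (hmax : 𝒟.IsMaximal)
    (hbad : ¬ 𝒟.HasCompleteFutureNullInfinityFar ∨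
      ∀ k : ℕ, ∀ 𝒟oc : Set 𝒟.carrier, ¬ 𝒟.toSpacetime.ConvergesToKerr 𝒟oc M 0 k) :
    ¬ BulkKerrCapture := by
  intro h
  obtain ⟨k, hk⟩ := bulkKerrCapture_atSchwarzschildData h hM
  obtain ⟨hfar, 𝒟oc, hconv⟩ := hk 𝒟 hmax
  rcases hbad with hfar' | hconv'
  · exact hfar' hfar
  · exact hconv' k 𝒟oc hconv

end Summit.FinalStateConjecture.FinalStateConjecture.Theorems.BulkKerrCapture.Negative

end
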